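import Summits.ResolutionOfSingularities.ResolutionOfSingularities.Theorems.UniformComplexityPrimeModelTransferSpecializationGraded
import Summits.ResolutionOfSingularities.ResolutionOfSingularities.Theorems.UniversalCellsProductDescentFibreGenericPoint
import Literature.AlgebraicGeometry.Limits.SubalgebraSpread
import Literature.AlgebraicGeometry.Limits.LocalizationProperSpread
import Literature.AlgebraicGeometry.Limits.LocalizationSmoothSpread
import Literature.AlgebraicGeometry.Limits.GenericProperCover
import Literature.AlgebraicGeometry.Limits.GenericSmoothnessSpread
import Literature.AlgebraicGeometry.Resolution.SmoothOfRegularPerfectField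
import Literature.AlgebraicGeometry.Resolution.SmoothStalksRegular
import Literature.AlgebraicGeometry.Morphisms.ReducedOfFlat
import Mathlib.AlgebraicGeometry.Morphisms.LocalFlatDescent
import Mathlib.AlgebraicGeometry.Morphisms.SchemeTheoreticallyDominant
import HarnessLib

/-!
# [OURS · L1 W8.2] SPECIALIZATION OF A RESOLUTION OVER A FIELD WITH DENSE RATIONAL POINTS
# (`X_L` resolvable ⇒ `X` resolvable, `K` NOT assumed algebraically closed)

Cell `res-hironaka` (run/shared/lean/pub/res-hironaka/), LADDER-RESOLUTION rung L (RESCUE), slot W8.2 of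
plan/RESCUE-SEED.md («PRIME-FIELD / UNIVERSALITY TRANSFER instead of descent»); host route `UniversalCells`, host
item `PrimeFieldToPerfect` (stmt-ResolutionOfSingularities-15233) = DOOR 1 (perfect constant fields). Proofs file
(Theses-free), written by res-L1-s82-pv-1 (gen 4).

WHAT. res-L1-s82-pv-2's door-2 specialization theorem (`PrimeModelTransfer.hasResolution_of_hasResolution_baseChange`,
p484634 / its single-resolution form): for `K` ALGEBRAICALLY CLOSED, `L ⊇ K` perfect and `X` proper integral over
`K`, a resolution of `X_L = X ×_K L` specialises to a resolution of `X`. Its proof uses algebraic closedness exactly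
twice: (i) `X_L` (and `X_R`, `R ⊆ L` finitely generated) is integral; (ii) a non-empty open subset of `Spec R` has a
closed point with residue field `K` (Nullstellensatz). THIS FILE removes the hypothesis `IsAlgClosed K` by turning
(i) and (ii) into explicit hypotheses — `X_L` integral, and «`K`-RATIONAL CLOSED POINTS ARE DENSE in `Spec R` for
every finitely generated `K`-algebra `R` embedding `K`-linearly into `L`» — with the same proof otherwise (verbatim
transcription of pv-2's Steps 2–9; Step 1's integrality of `X_R` is now obtained from that of `X_L` by schematic
dominance of `X_L ⟶ X_R`, the flat base change of the dominant `Spec L ⟶ Spec R`). Door 1 needs exactly this: for a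
PERFECT `M` and `L = (M(t))^{perf}` both hypotheses hold (sibling files `…PerfectionDescentAlgebra.lean`,
`…PerfectionDescent.lean`), giving THE INVERSE OF THE PERFECTION STEP: resolution over `(M(t))^{perf}` implies
resolution over `M`.

* `hasResolution_of_hasResolution_baseChange_of_rationalPoints` — the proper case, one resolution (the graded and
  separated forms are in the sibling `…PerfectionDescent.lean`).

HONEST FRAMING. OURS theorems about OURS statements (role replaced: §17 ¶2 p.89 l.59–62 of [Hironaka2017], typed AS
PRINTED as `S17Methodology.U89_3`); NOT statements of the manuscript; nothing attributed to its author. Only SMOOTH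
models are base-changed, and only specialised at `K`-rational points. AI work, weaker than expert review.

Sources: EGA IV₃ (1966) Thm. 8.8.2, 8.10.5, EGA IV₄ (1967) Prop. 17.7.8; The Stacks Project, Tags 01ZM, 081F,
0C0C, 02L4; pv-2's files named above (the proof transcribed). [cite: EGAIV3, Thm. 8.10.5]
[cite: StacksProject, Tag 081F]
-/

noncomputable section

set_option linter.dupNamespace false -- mandated namespace of this single-conjunct summit

open CategoryTheory CategoryTheory.Limits AlgebraicGeometry TopologicalSpace
open Literature.AlgebraicGeometry.Resolution
open Summit.ResolutionOfSingularities.ResolutionOfSingularities.Theorems.PrimeModelTransfer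

namespace Summit.ResolutionOfSingularities.ResolutionOfSingularities.Theorems.CampaignW82

open MonoidalCategory CartesianMonoidalCategory
open Literature.AlgebraicGeometry.Limits Literature.AlgebraicGeometry.Limits.LocApprox
open Literature.AlgebraicGeometry.Motives (SchemeOver specOver)

set_option backward.isDefEq.respectTransparency false

/-- Over a locally Noetherian base, locally of finite type implies locally of finite
presentation. [folklore] -/
private theorem lofp_of_isLocallyNoetherian {Y T : Scheme.{0}}
    (q : Y ⟶ T) [LocallyOfFiniteType q] [IsLocallyNoetherian T] :
    LocallyOfFinitePresentation q := by
  rw [HasRingHomProperty.iff_appLE (P := @LocallyOfFinitePresentation)]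
  intro U V e
  haveI := IsLocallyNoetherian.component_noetherian (X := T) U
  exact RingHom.FinitePresentation.of_finiteType.mp
    (HasRingHomProperty.appLE @LocallyOfFiniteType q inferInstance U V e)

/-- **SPECIALIZATION OF ONE RESOLUTION at a `K`-rational point, proper case, `K` any field.** Let `K ⊆ L` be
fields with `L` perfect, such that (`hrat`) for every `K`-algebra `R` of finite type with an injective `K`-algebra
map `R → L`, every non-empty open subset of `Spec R` contains a closed point `𝔪` with `K → R/𝔪` bijective. Let
`X → Spec K` be proper with `X` integral and `X_L := X ×_K L` integral. If `X_L` has a resolution, then so has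
`X`. Proof (res-L1-s82-pv-2's, p484634, transcribed): a resolution `π : Y → X_L` has `Y` smooth and proper over
the perfect `L`; `π` spreads out to a separated finite-type `G : Y_R → X_R := X ×_K Spec R` over a finitely
generated `K`-subalgebra `R ⊆ L` (`Limits.exists_isPullback_whisker_of_hom_tensorObj`); `X_R` is integral
because `X_L ⟶ X_R`, the flat base change of the dominant quasi-compact `Spec L ⟶ Spec R`, is schematically
dominant with integral source; over `F = Frac R` the structure map `Y_F → Spec F` is smooth and proper by fpqc
descent from `L`, hence so is `Y ×_R R[1/t] → Spec R[1/t]` for some `t ≠ 0`; `G` is an isomorphism over a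
non-empty open `W ⊆ X_R` (it is one at the generic point by descent from `π`); at a `K`-rational closed point
`a ∈ D(t)` in the (open) image of `W` (hypothesis `hrat`), the fibre `Y_a → X_a ≅ X` is proper, from a regular
(smooth over `κ(a) = K`) Noetherian scheme, and an isomorphism over the non-empty open `W_a`, whence a resolution
of `X` (`PrimeModelTransfer.hasResolution_of_isIso_morphismRestrict`). [cite: EGAIV3, Thm. 8.10.5] -/
theorem hasResolution_of_hasResolution_baseChange_of_rationalPoints (K : Type) [Field K]
    (L : Type) [Field L] [Algebra K L] [PerfectField L]
    (hrat : ∀ (R : Type) [CommRing R] [Algebra K R], Algebra.FiniteType K R →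
      ∀ ψ : R →ₐ[K] L, Function.Injective ψ →
        ∀ O : Set (PrimeSpectrum R), IsOpen O → O.Nonempty →
          ∃ x ∈ O, x.asIdeal.IsMaximal ∧ Function.Bijective (algebraMap K (R ⧸ x.asIdeal)))
    (X : Scheme.{0}) (f : X ⟶ Spec (.of K)) [IsProper f] [IsIntegral X]
    [hXL : IsIntegral (pullback f (Spec.map (CommRingCat.ofHom (algebraMap K L))) : Scheme.{0})]
    (h : Scheme.HasResolution
      (pullback f (Spec.map (CommRingCat.ofHom (algebraMap K L))) : Scheme.{0})) :
    Scheme.HasResolution X := by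
  classical
  -- ### Step 1: `X_L = X ×_K Spec L` is integral and proper over `L`
  let X₀ : SchemeOver K := Over.mk f
  haveI : IsProper X₀.hom := ‹IsProper f›
  haveI : QuasiCompact X₀.hom := inferInstance
  haveI : IsSeparated X₀.hom := inferInstance
  haveI : LocallyOfFinitePresentation X₀.hom := lofp_of_isLocallyNoetherian f
  let XL : Scheme.{0} := (X₀ ⊗ specOver K L).left
  let fstL : XL ⟶ X := pullback.fst X₀.hom (specOver K L).hom
  let fL : XL ⟶ Spec (.of L) := pullback.snd X₀.hom (specOver K L).hom
  haveI : IsIntegral XL := hXL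
  haveI : IsProper fL := inferInstance
  -- ### Step 2: a resolution of `X_L`; its source is integral, smooth and proper over `L`
  obtain ⟨Y, π, hres⟩ :
      ∃ (Y : Scheme.{0}) (π : Y ⟶ XL), Literature.AlgebraicGeometry.Resolution.IsResolution π := h
  haveI := hres.isProper
  obtain ⟨U, hUd, hUpre, hUiso⟩ := hres.isBirational
  haveI := hUiso
  haveI : IrreducibleSpace Y := IsBirational.irreducibleSpace ⟨U, hUd, hUpre, hUiso⟩
  haveI : IsReduced Y := hres.isRegular.isReduced
  haveI : IsIntegral Y := isIntegral_of_irreducibleSpace_of_isReduced Y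
  haveI hYsm : Smooth (π ≫ fL) := smooth_of_isRegular_of_perfectField (π ≫ fL) hres.isRegular
  haveI hYpr : IsProper (π ≫ fL) := inferInstance
  have hUξ : genericPoint XL ∈ U := by
    haveI : Nonempty U := (hUd.nonempty).to_subtype
    exact ((genericPoint_spec XL).mem_open_set_iff U.isOpen).mpr (by simpa using ‹Nonempty U›)
  -- ### Step 3: spread `π` out over a finitely generated `K`-subalgebra `R ⊆ L`
  obtain ⟨R, _, _, ψ, YR, G, πR, ℓ, hψ, hRft, hGsep, hGlft, hGqc, hℓ₁, hℓ₂, hsq⟩ :=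
    Literature.AlgebraicGeometry.Limits.exists_isPullback_whisker_of_hom_tensorObj (K := K) (B := L)
      X₀ π
  haveI := hRft; haveI := hGsep; haveI := hGlft; haveI := hGqc
  haveI : IsDomain R := Function.Injective.isDomain ψ.toRingHom hψ
  haveI : IsNoetherianRing R := Algebra.FiniteType.isNoetherianRing K R
  let XR : Scheme.{0} := (X₀ ⊗ specOver K R).left
  let fstR : XR ⟶ X := pullback.fst X₀.hom (specOver K R).hom
  let fR : XR ⟶ Spec (.of R) := pullback.snd X₀.hom (specOver K R).hom
  let iψ : Spec (.of L) ⟶ Spec (.of R) := Spec.map (CommRingCat.ofHom ψ.toRingHom)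
  have hiψ : iψ ≫ (specOver K R).hom = (specOver K L).hom := by
    change Spec.map _ ≫ Spec.map _ = Spec.map _
    rw [← Spec.map_comp, ← CommRingCat.ofHom_comp]
    congr 2
    exact ψ.comp_algebraMap
  haveI : Subsingleton ↥(Spec (CommRingCat.of K)) := inferInstanceAs (Subsingleton (PrimeSpectrum K))
  haveI : Flat X₀.hom := inferInstance
  haveI : UniversallyOpen X₀.hom := inferInstance
  haveI : IsIntegral (specOver K R).left := inferInstanceAs (IsIntegral (Spec (CommRingCat.of R)))
  haveI : IsLocallyNoetherian (specOver K R).left :=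
    inferInstanceAs (IsLocallyNoetherian (Spec (CommRingCat.of R)))
  haveI : IsNoetherian XR := Literature.AlgebraicGeometry.Limits.isNoetherian_of_locallyOfFiniteType fR
  -- the square `X_L → X_R` over `Spec L → Spec R`
  have hsqℓ : IsPullback ℓ fL fR iψ := by
    refine IsPullback.of_right (h₁₂ := fstR) (v₁₃ := f) (h₂₂ := (specOver K R).hom) ?_ hℓ₂
      (IsPullback.of_hasPullback X₀.hom (specOver K R).hom)
    rw [hℓ₁, hiψ]
    exact IsPullback.of_hasPullback X₀.hom (specOver K L).hom
  -- `X_R` is integral: `X_L ⟶ X_R` is schematically dominant (flat base change of the dominant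
  -- quasi-compact `Spec L ⟶ Spec R`) with integral source
  haveI : Subsingleton ↥(Spec (CommRingCat.of L)) := inferInstanceAs (Subsingleton (PrimeSpectrum L))
  haveI : Nonempty ↥(Spec (CommRingCat.of L)) := inferInstanceAs (Nonempty (PrimeSpectrum L))
  have hηψ : ∀ ηL : ↥(Spec (CommRingCat.of L)), iψ ηL = (⊥ : PrimeSpectrum R) := by
    intro ηL
    apply PrimeSpectrum.ext
    change Ideal.comap ψ.toRingHom ηL.asIdeal = ⊥
    haveI : Subsingleton (PrimeSpectrum L) := inferInstance
    have : ηL.asIdeal = ⊥ := by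
      have h := Subsingleton.elim ηL (⟨⊥, Ideal.isPrime_bot⟩ : PrimeSpectrum L)
      rw [h]
    rw [this]
    exact Ideal.comap_bot_of_injective _ hψ
  haveI : IsDominant iψ := by
    rw [isDominant_iff, DenseRange, dense_iff_closure_eq, Set.eq_univ_iff_forall]
    intro y
    have hgen : iψ (Nonempty.some inferInstance) ⤳ y := by
      rw [hηψ]
      have hg := genericPoint_specializes (α := ↥(Spec (CommRingCat.of R))) y
      rwa [genericPoint_eq_bot_of_affine] at hg
    exact hgen.mem_closed isClosed_closure (subset_closure ⟨_, rfl⟩)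
  haveI : IsSchemeTheoreticallyDominant iψ := IsSchemeTheoreticallyDominant.of_isDominant iψ
  haveI : Flat fR := inferInstance
  haveI : IsSchemeTheoreticallyDominant ℓ := IsSchemeTheoreticallyDominant.of_isPullback hsqℓ.flip
  haveI : QuasiCompact ℓ := MorphismProperty.of_isPullback hsqℓ.flip inferInstance
  haveI : IsReduced XR := IsSchemeTheoreticallyDominant.isReduced ℓ
  haveI : IrreducibleSpace XR := by
    have h1 : IsIrreducible (Set.range ℓ) := by
      rw [← Set.image_univ]
      exact (IrreducibleSpace.isIrreducible_univ XL).image _ ℓ.continuous.continuousOn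
    have h2 := h1.closure
    rw [ℓ.denseRange.closure_range] at h2
    exact (irreducibleSpace_def XR).mpr h2
  haveI : IsIntegral XR := isIntegral_of_irreducibleSpace_of_isReduced XR
  -- `ℓ` maps the generic point to the generic point
  haveI : Nonempty ↥X₀.left := inferInstanceAs (Nonempty X)
  haveI : Surjective X₀.hom := ⟨fun y => ⟨Nonempty.some inferInstance, Subsingleton.elim _ _⟩⟩
  haveI : Surjective fR := inferInstance
  have hfRξ : fR (genericPoint XR) = (⊥ : PrimeSpectrum R) := by
    have := ProductDescent.Birth.apply_genericPoint_of_surjective fR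
    rw [genericPoint_eq_bot_of_affine] at this
    exact this
  have hℓξ : ℓ (genericPoint XL) = genericPoint XR := by
    -- the generic point of `X_R` lies over the generic point of `Spec R`, which is hit by `Spec L`
    let ηL : ↥(Spec (CommRingCat.of L)) := Nonempty.some inferInstance
    obtain ⟨z, hz, -⟩ := Scheme.Pullback.exists_preimage_pullback (f := fR) (g := iψ)
      (genericPoint XR) ηL (by rw [hfRξ, hηψ])
    have hz' : ℓ (hsqℓ.isoPullback.inv z) = genericPoint XR := by
      rw [← Scheme.Hom.comp_apply, IsPullback.isoPullback_inv_fst]; exact hz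
    have h1 : ℓ (genericPoint XL) ⤳ genericPoint XR := by
      rw [← hz']
      exact ((genericPoint_spec XL).specializes trivial).map ℓ.continuous
    exact (h1.antisymm ((genericPoint_spec XR).specializes trivial)).eq
  -- ### Step 4: `G` is an isomorphism over a non-empty open `W ⊆ X_R`
  haveI : LocallyOfFinitePresentation G := lofp_of_isLocallyNoetherian G
  haveI : QuasiSeparated G := inferInstance
  haveI := isIso_pullback_snd_fromSpecStalk_genericPoint_of_isPullback hsq hℓξ U hUξ
  obtain ⟨W, hWne, hWiso⟩ :=
    exists_isIso_morphismRestrict_of_isIso_pullback_snd_fromSpecStalk G (x := genericPoint XR) rfl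
  haveI := hWiso
  have hξW : genericPoint XR ∈ W :=
    ((genericPoint_spec XR).mem_open_set_iff W.isOpen).mpr (by simpa using hWne)
  -- ### Step 5: the fraction field `F` of `R`, the model `P = (Y_R → Spec R)`, and descent from `L`
  let qR : YR ⟶ Spec (.of R) := G ≫ fR
  haveI : IsSeparated qR := inferInstance
  haveI : LocallyOfFiniteType qR := inferInstance
  haveI : QuasiCompact qR := inferInstance
  let P : SchemeOver R := Over.mk qR
  haveI : QuasiCompact P.hom := ‹QuasiCompact qR›
  haveI : IsSeparated P.hom := ‹IsSeparated qR›
  haveI : QuasiSeparated P.hom := inferInstance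
  haveI : LocallyOfFiniteType P.hom := ‹LocallyOfFiniteType qR›
  haveI : LocallyOfFinitePresentation P.hom := lofp_of_isLocallyNoetherian qR
  -- `Y = Y_R ×_R Spec L`
  have hsqY : IsPullback πR (π ≫ fL) qR iψ := hsq.paste_vert hsqℓ
  -- the fraction field
  let F : Type := FractionRing R
  letI : Algebra R L := ψ.toRingHom.toAlgebra
  have hψ' : Function.Injective (algebraMap R L) := hψ
  let φ : F →+* L := IsFractionRing.lift hψ'
  let iF : Spec (.of F) ⟶ Spec (.of R) := Spec.map (CommRingCat.ofHom (algebraMap R F))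
  let jF : Spec (.of L) ⟶ Spec (.of F) := Spec.map (CommRingCat.ofHom φ)
  have hjF : jF ≫ iF = iψ := by
    change Spec.map _ ≫ Spec.map _ = Spec.map _
    rw [← Spec.map_comp, ← CommRingCat.ofHom_comp]
    congr 2
    exact RingHom.ext fun x => IsFractionRing.lift_algebraMap hψ' x
  let YF : Scheme.{0} := pullback P.hom iF
  let qF : YF ⟶ Spec (.of F) := pullback.snd P.hom iF
  -- `Y → Y_F` is cartesian over `Spec L → Spec F`
  let m : Y ⟶ YF := pullback.lift πR ((π ≫ fL) ≫ jF)
    (by rw [Category.assoc, hjF]; exact hsqY.w)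
  have hsqYF : IsPullback m (π ≫ fL) qF jF := by
    have outer : IsPullback (m ≫ pullback.fst P.hom iF) (π ≫ fL) qR (jF ≫ iF) := by
      rw [pullback.lift_fst, hjF]; exact hsqY
    exact outer.of_right (pullback.lift_snd _ _ _) (IsPullback.of_hasPullback P.hom iF)
  -- `Spec L → Spec F` is flat, surjective and quasi-compact; descend smoothness and properness
  haveI : Subsingleton ↥(Spec (CommRingCat.of F)) := inferInstanceAs (Subsingleton (PrimeSpectrum F))
  haveI : Subsingleton ↥(Spec (CommRingCat.of L)) := inferInstanceAs (Subsingleton (PrimeSpectrum L))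
  haveI : Nonempty ↥(Spec (CommRingCat.of L)) := inferInstanceAs (Nonempty (PrimeSpectrum L))
  haveI : Flat jF := by
    letI : Algebra F L := φ.toAlgebra
    haveI hflat : Module.Flat F L := inferInstance
    rw [show jF = Spec.map (CommRingCat.ofHom (algebraMap F L)) from rfl, Flat.SpecMap_iff,
      CommRingCat.hom_ofHom]
    exact RingHom.flat_algebraMap_iff.mpr hflat
  haveI : Surjective jF := inferInstance
  have hQ : (@Surjective ⊓ @Flat ⊓ @QuasiCompact : MorphismProperty Scheme.{0}) jF :=
    ⟨⟨‹Surjective jF›, ‹Flat jF›⟩, inferInstance⟩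
  haveI hsmF : Smooth qF :=
    MorphismProperty.of_isPullback_of_descendsAlong (P := @Smooth) hsqYF.flip hQ hYsm
  haveI : UniversallyClosed qF :=
    MorphismProperty.of_isPullback_of_descendsAlong (P := @UniversallyClosed) hsqYF.flip hQ
      inferInstance
  haveI : IsSeparated qF := inferInstance
  haveI : LocallyOfFiniteType qF := inferInstance
  haveI hprF : IsProper qF := ⟨⟩
  -- `Y_F` is integral (`Y → Y_F` is flat and surjective)
  haveI : Flat m := MorphismProperty.of_isPullback (P := @Flat) hsqYF.flip ‹Flat jF›
  haveI : Surjective m :=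
    MorphismProperty.of_isPullback (P := @Surjective) hsqYF.flip ‹Surjective jF›
  haveI : IsReduced YF := Literature.AlgebraicGeometry.Morphisms.isReduced_of_flat_of_surjective m
  haveI : IrreducibleSpace YF := Function.Surjective.irreducibleSpace m.continuous m.surjective
  haveI : IsIntegral YF := isIntegral_of_irreducibleSpace_of_isReduced YF
  -- ### Step 6: smoothness and properness spread from `F = Frac R` to some `D(t)`
  obtain ⟨s₂, hs₂S, hs₂⟩ := LocApprox.exists_forall_smooth_snd (nonZeroDivisors R) F P hsmF
  let E : SchemeOver F := (Over.pullback (specOver R F).hom).obj P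
  haveI : IsProper E.hom := hprF
  haveI : IsIntegral E.left := ‹IsIntegral YF›
  obtain ⟨Yc, a, hYc, ha⟩ := exists_proper_generic_cover P E (Iso.refl _)
  haveI := hYc
  haveI : QuasiCompact Yc.hom := inferInstance
  haveI : QuasiSeparated Yc.hom := inferInstance
  obtain ⟨s₁, g, hg⟩ := LocApprox.exists_whiskerLeft_comp_eq F (S := nonZeroDivisors R) (P := Yc) a
  let t : Idx (nonZeroDivisors R) := ⟨s₁.val * s₂, mul_mem s₁.mem hs₂S⟩
  have ht₁ : t ≤ s₁ := Idx.le_iff.mpr (dvd_mul_right _ _)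
  have ht₂ : s₂ ∣ t.val := dvd_mul_left _ _
  haveI hsmt : Smooth (pullback.snd P.hom ((baseDiagram (nonZeroDivisors R)).obj t).hom) :=
    hs₂ t.val ht₂ (loc (nonZeroDivisors R) t)
  haveI : Flat (pullback.snd P.hom ((baseDiagram (nonZeroDivisors R)).obj t).hom) := inferInstance
  haveI : IsSeparated (pullback.snd P.hom ((baseDiagram (nonZeroDivisors R)).obj t).hom) :=
    inferInstance
  have hgt : (Yc ◁ leg (nonZeroDivisors R) F t) ≫ ((Yc ◁ (baseDiagram _).map (homOfLE ht₁)) ≫ g) = a := by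
    rw [← MonoidalCategory.whiskerLeft_comp_assoc, leg_comp_map, hg]
  have ha' : Function.Surjective (lift ((Yc ◁ leg (nonZeroDivisors R) F t) ≫
      ((Yc ◁ (baseDiagram _).map (homOfLE ht₁)) ≫ g)) (snd Yc (specOver R F))).left := by
    rw [hgt]; exact ha
  haveI hprt : IsProper (pullback.snd P.hom ((baseDiagram (nonZeroDivisors R)).obj t).hom) :=
    isProper_snd_of_generic_cover (B := F) le_rfl Yc P t _ ha'
  -- the stage `Spec R[1/t] ⊆ Spec R`
  let Rt : Type := Localization.Away t.val
  let it : Spec (.of Rt) ⟶ Spec (.of R) := Spec.map (CommRingCat.ofHom (algebraMap R Rt))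
  let qt : pullback qR it ⟶ Spec (.of Rt) := pullback.snd qR it
  haveI : Smooth qt := hsmt
  haveI : IsProper qt := hprt
  have ht0 : t.val ≠ 0 := nonZeroDivisors.ne_zero t.mem
  -- ### Step 7: a `K`-rational closed point `a ∈ D(t)` over which `W` has a point
  haveI : UniversallyOpen fR := inferInstance
  let O : Set (PrimeSpectrum R) := (PrimeSpectrum.basicOpen t.val : Set (PrimeSpectrum R)) ∩
    fR.base '' (W : Set XR)
  have hO : IsOpen O := (PrimeSpectrum.basicOpen t.val).2.inter (fR.isOpenMap _ W.2)
  have hOne : O.Nonempty :=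
    ⟨⊥, (PrimeSpectrum.mem_basicOpen _ _).mpr (by simpa using ht0), ⟨genericPoint XR, hξW, hfRξ⟩⟩
  obtain ⟨x, hxO, hxmax, hbij⟩ := hrat R hRft ψ hψ O hO hOne
  haveI := hxmax
  let κ : Type := R ⧸ x.asIdeal
  letI : Field κ := Ideal.Quotient.field x.asIdeal
  have htu : IsUnit (Ideal.Quotient.mk x.asIdeal t.val) := by
    rw [isUnit_iff_ne_zero, Ne, Ideal.Quotient.eq_zero_iff_mem]
    exact (PrimeSpectrum.mem_basicOpen _ _).mp hxO.1
  let lt : Rt →+* κ := IsLocalization.Away.lift t.val htu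
  have hlt : lt.comp (algebraMap R Rt) = Ideal.Quotient.mk x.asIdeal :=
    IsLocalization.Away.lift_comp (x := t.val) htu
  let ct : Spec (.of κ) ⟶ Spec (.of Rt) := Spec.map (CommRingCat.ofHom lt)
  let c₀ : Spec (.of κ) ⟶ Spec (.of R) := ct ≫ it
  have hc₀ : c₀ = Spec.map (CommRingCat.ofHom (Ideal.Quotient.mk x.asIdeal)) := by
    change Spec.map _ ≫ Spec.map _ = _
    rw [← Spec.map_comp, ← CommRingCat.ofHom_comp, hlt]
  haveI : Subsingleton ↥(Spec (CommRingCat.of κ)) := inferInstanceAs (Subsingleton (PrimeSpectrum κ))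
  haveI : Nonempty ↥(Spec (CommRingCat.of κ)) := inferInstanceAs (Nonempty (PrimeSpectrum κ))
  have hc₀x : ∀ p : ↥(Spec (CommRingCat.of κ)), c₀ p = x := by
    intro p
    rw [hc₀]
    apply PrimeSpectrum.ext
    change Ideal.comap (Ideal.Quotient.mk x.asIdeal) p.asIdeal = x.asIdeal
    have hp : p = (⟨⊥, Ideal.isPrime_bot⟩ : PrimeSpectrum κ) := Subsingleton.elim _ _
    rw [hp, ← RingHom.ker_eq_comap_bot, Ideal.mk_ker]
  -- `K ≅ κ(a)`
  have hcK : c₀ ≫ (specOver K R).hom = Spec.map (CommRingCat.ofHom (algebraMap K κ)) := by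
    rw [hc₀]
    change Spec.map _ ≫ Spec.map _ = _
    rw [← Spec.map_comp, ← CommRingCat.ofHom_comp]
    rfl
  let eκ : K ≃+* κ := RingEquiv.ofBijective (algebraMap K κ) hbij
  haveI : IsIso (Spec.map (CommRingCat.ofHom (algebraMap K κ))) :=
    inferInstanceAs (IsIso (Spec.map eκ.toCommRingCatIso.hom))
  haveI : IsIso (c₀ ≫ (specOver K R).hom) := by rw [hcK]; infer_instance
  -- ### Step 8: the fibres over `a`: `G_a : Y_a → X_a ≅ X`
  let Xa : Scheme.{0} := pullback fR c₀
  let ga : Xa ⟶ XR := pullback.fst fR c₀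
  let pa : Xa ⟶ Spec (.of κ) := pullback.snd fR c₀
  let Ya : Scheme.{0} := pullback G ga
  let Ga : Ya ⟶ Xa := pullback.snd G ga
  -- `Y_a → Spec κ(a)` is a base change of `Y_R ×_R R[1/t] → Spec R[1/t]`: smooth and proper
  have hqa : Ga ≫ pa = (pullbackRightPullbackFstIso fR c₀ G).hom ≫
      (pullbackLeftPullbackSndIso qR it ct).inv ≫ pullback.snd qt ct := by
    rw [pullbackLeftPullbackSndIso_inv_snd_snd, pullbackRightPullbackFstIso_hom_snd]
  haveI : Smooth (Ga ≫ pa) := by rw [hqa]; infer_instance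
  haveI : IsProper (Ga ≫ pa) := by rw [hqa]; infer_instance
  haveI : IsSeparated pa := inferInstance
  haveI : IsProper Ga := IsProper.of_comp Ga pa
  have hYareg : Scheme.IsRegular Ya := fun y => isRegularLocalRing_stalk_of_smooth_of_field (Ga ≫ pa) y
  haveI : IsNoetherian Ya :=
    Literature.AlgebraicGeometry.Limits.isNoetherian_of_locallyOfFiniteType (Ga ≫ pa)
  haveI : NoetherianSpace Ya := inferInstance
  -- `G_a` is an isomorphism over the non-empty open `W_a = W ×_{X_R} X_a`
  let Wa : Xa.Opens := ga ⁻¹ᵁ W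
  haveI : IsIso (Ga ∣_ Wa) :=
    Literature.AlgebraicGeometry.Morphisms.isIso_morphismRestrict_pullback_snd G ga W
  obtain ⟨w, hwW, hwx⟩ := hxO.2
  obtain ⟨z, hz, -⟩ := Scheme.Pullback.exists_preimage_pullback (f := fR) (g := c₀) w
    (Nonempty.some inferInstance) (by rw [hc₀x]; exact hwx)
  have hWane : (Wa : Set Xa).Nonempty := ⟨z, show ga z ∈ W by rw [hz]; exact hwW⟩
  -- `X_a ≅ X` (`κ(a) = K`), in particular `X_a` is irreducible
  let toX : Xa ⟶ X := (pullbackLeftPullbackSndIso X₀.hom (specOver K R).hom c₀).hom ≫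
    pullback.fst X₀.hom (c₀ ≫ (specOver K R).hom)
  haveI : IsIso toX := inferInstance
  haveI : IrreducibleSpace Xa :=
    Function.Surjective.irreducibleSpace (inv toX).continuous (inv toX).surjective
  -- ### Step 9: conclude
  exact Scheme.HasResolution.of_iso toX
    (hasResolution_of_isIso_morphismRestrict Ga hYareg Wa hWane)

end Summit.ResolutionOfSingularities.ResolutionOfSingularities.Theorems.CampaignW82

end
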